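import Literature.NumberTheory.Automorphic.AdelicGLnGlue
import Mathlib.Analysis.Matrix.Normed
import Mathlib.Analysis.Matrix.Order
import Mathlib.Analysis.Convex.Basic
import Mathlib.Topology.Algebra.Module.FiniteDimension
import HarnessLib

/-!
# The hermitian cone of `Res_{K/ℚ} GL_n`: the symmetric space as an open convex cone in a real
# normed space with a LINEAR action

Topic `NumberTheory/Automorphic`; namespace `Literature.NumberTheory.Automorphic.ResGLnCone`.
Definitions with bodies and theorems; no named fact, no `sorry`.

For a number field `K` let `K_∞ = K ⊗_ℚ ℝ = mixedSpace K = ℝ^{r₁} × ℂ^{r₂}` (a commutative real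
`*`-algebra).  The **hermitian space** `hermSpace n K` is the real vector space of self-adjoint
`n × n` matrices `H = Hᴴ` over `K_∞` (symmetric at the real places, hermitian at the complex ones),
normed as a subspace of `M_n(K_∞)` with the elementwise sup norm (Mathlib's `Matrix.normedAddCommGroup`,
scope `Matrix.Norms.Elementwise`, with `Classical` for the finiteness of the sets of places; any norm
would do — the space is finite-dimensional); the
**positive cone** `posCone n K ⊆ hermSpace n K` consists of the `H` which are positive definite at
every place.  `GL_n(K_∞)` acts on `hermSpace n K` by the CONTINUOUS LINEAR maps
`coneAction n K g : H ↦ g H gᴴ` (a monoid homomorphism `GL_n(K_∞) →* (hermSpace →L[ℝ] hermSpace)`),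
preserving the cone (`mapsTo_coneAction_posCone`), which is convex (`convex_posCone`) and contains the
base point `hermOne = 1` (`hermOne_mem_posCone`) whose stabiliser is `K_∞`; so
`posCone n K ≅ GL_n(K_∞)/K_∞` is the symmetric space of `Res_{K/ℚ} GL_n` (times the split centre)
[cite: Borel1969, §12] [cite: BorelSerre1973, §11], realised as a convex cone on which the group acts
LINEARLY — the model in which closed equivariant differential forms are turned into group cocycles by
integration over straight simplices (`Literature/Analysis/Calculus/ConeCube.lean`,
`TwistedQuotientConeClass.lean`).  Rational points act through
`coneActionRat n K = coneAction ∘ GL_n(mixedEmbedding K)`.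

Openness of the cone in `hermSpace` and transitivity of the action are not needed here and are not
proved (transitivity, the stabiliser and invariance appear, for the ambient matrix space, in the
Borel–Serre programme of `Summits/…/HeckeEigenvalueFieldStubConeModel.lean`, from which the place-wise
arguments below are adapted).

## References

* A. Borel, *Introduction aux groupes arithmétiques*, Hermann 1969, §12. [Borel1969]
* A. Borel, J.-P. Serre, *Corners and arithmetic groups*, Comment. Math. Helv. 48 (1973), §11.
  [BorelSerre1973]
-/

noncomputable section

open scoped ComplexOrder Matrix Matrix.Norms.Elementwise Classical
open NumberField NumberField.mixedEmbedding Set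

namespace Literature.NumberTheory.Automorphic

namespace ResGLnCone

variable (n : ℕ) (K : Type) [Field K]

/-! ### The hermitian space -/

/-- **The hermitian space**: self-adjoint `n × n` matrices over `K_∞ = mixedSpace K`, a real
subspace of `M_n(K_∞)` (`star` is trivial on `ℝ`, so real scalars preserve self-adjointness).
[cite: Borel1969, §12] -/
def hermSpace : Submodule ℝ (Matrix (Fin n) (Fin n) (mixedSpace K)) where
  carrier := {H | Hᴴ = H}
  zero_mem' := Matrix.conjTranspose_zero
  add_mem' {A B} hA hB := by
    simp only [mem_setOf_eq] at hA hB ⊢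
    rw [Matrix.conjTranspose_add, hA, hB]
  smul_mem' c A hA := by
    simp only [mem_setOf_eq] at hA ⊢
    rw [Matrix.conjTranspose_smul, hA, star_trivial]

variable {n K} in
/-- Membership in the hermitian space: `Hᴴ = H`. [folklore] -/
theorem mem_hermSpace_iff (H : Matrix (Fin n) (Fin n) (mixedSpace K)) :
    H ∈ hermSpace n K ↔ Hᴴ = H :=
  Iff.rfl

/-- The hermitian space is a normed group (elementwise sup norm of the ambient matrix space; all
norms on this finite-dimensional space are equivalent). [folklore] -/
instance instNormedAddCommGroup [NumberField K] : NormedAddCommGroup (hermSpace n K) :=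
  Submodule.normedAddCommGroup (hermSpace n K)

/-- The hermitian space is a real normed space. [folklore] -/
instance instNormedSpace [NumberField K] : NormedSpace ℝ (hermSpace n K) :=
  Submodule.normedSpace (hermSpace n K)

/-- The hermitian space is finite-dimensional over `ℝ`. [folklore] -/
instance instFiniteDimensional [NumberField K] : FiniteDimensional ℝ (hermSpace n K) :=
  FiniteDimensional.finiteDimensional_submodule _

/-- The base point `1 ∈ hermSpace n K`. [folklore] -/
def hermOne : hermSpace n K :=
  ⟨1, Matrix.conjTranspose_one⟩

/-- `hermOne` is the identity matrix. [folklore] -/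
@[simp]
theorem coe_hermOne : ((hermOne n K : hermSpace n K) : Matrix (Fin n) (Fin n) (mixedSpace K)) = 1 :=
  rfl

/-! ### The positive cone -/

/-- **The positive cone**: self-adjoint matrices over `K_∞` which are positive definite at every
real and every complex place (`Matrix.PosDef` of the evaluations). [cite: Borel1969, §12] -/
def posCone : Set (hermSpace n K) :=
  {H | (∀ w, ((H : Matrix (Fin n) (Fin n) (mixedSpace K)).map (mixedSpaceEvalReal K w)).PosDef) ∧
    ∀ w, ((H : Matrix (Fin n) (Fin n) (mixedSpace K)).map (mixedSpaceEvalComplex K w)).PosDef}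

variable {n K} in
/-- Membership in the positive cone. [folklore] -/
theorem mem_posCone_iff (H : hermSpace n K) :
    H ∈ posCone n K ↔
      (∀ w, ((H : Matrix (Fin n) (Fin n) (mixedSpace K)).map (mixedSpaceEvalReal K w)).PosDef) ∧
        ∀ w, ((H : Matrix (Fin n) (Fin n) (mixedSpace K)).map (mixedSpaceEvalComplex K w)).PosDef :=
  Iff.rfl

/-- **The base point lies in the cone**: `1` is positive definite at every place. [folklore] -/
theorem hermOne_mem_posCone : hermOne n K ∈ posCone n K := by
  classical
  refine ⟨fun w => ?_, fun w => ?_⟩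
  · rw [coe_hermOne, Matrix.map_one _ (map_zero _) (map_one _)]
    exact Matrix.PosDef.one
  · rw [coe_hermOne, Matrix.map_one _ (map_zero _) (map_one _)]
    exact Matrix.PosDef.one

/-- **The cone is convex** (evaluation at a place is `ℝ`-linear and `a A + b B` is positive definite
for positive definite `A, B` and `a, b > 0`). [cite: Borel1969, §12] -/
theorem convex_posCone : Convex ℝ (posCone n K) := by
  -- adapted from Summits/…/HeckeEigenvalueFieldStubConeModel.lean (coneModel_convex)
  refine convex_iff_forall_pos.mpr ?_
  rintro X ⟨hXR, hXC⟩ Y ⟨hYR, hYC⟩ a b ha hb -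
  refine ⟨fun w => ?_, fun w => ?_⟩
  · rw [Submodule.coe_add, Submodule.coe_smul, Submodule.coe_smul, Matrix.map_add _ (map_add _),
      Matrix.map_smul (mixedSpaceEvalReal K w) a (fun _ => rfl),
      Matrix.map_smul (mixedSpaceEvalReal K w) b (fun _ => rfl)]
    exact ((hXR w).smul ha).add ((hYR w).smul hb)
  · rw [Submodule.coe_add, Submodule.coe_smul, Submodule.coe_smul, Matrix.map_add _ (map_add _),
      Matrix.map_smul (mixedSpaceEvalComplex K w) a (fun _ => rfl),
      Matrix.map_smul (mixedSpaceEvalComplex K w) b (fun _ => rfl)]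
    exact ((hXC w).smul ha).add ((hYC w).smul hb)

/-! ### The linear action `H ↦ g H gᴴ` -/

variable {n K} in
/-- `g H gᴴ` is self-adjoint with `H`. [folklore] -/
theorem conj_mem_hermSpace (g : Matrix (Fin n) (Fin n) (mixedSpace K)) {H : Matrix (Fin n) (Fin n) (mixedSpace K)}
    (hH : H ∈ hermSpace n K) : g * H * gᴴ ∈ hermSpace n K := by
  rw [mem_hermSpace_iff] at hH ⊢
  rw [Matrix.conjTranspose_mul, Matrix.conjTranspose_mul, Matrix.conjTranspose_conjTranspose, hH,
    Matrix.mul_assoc]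

/-- The action of `g ∈ GL_n(K_∞)` on the hermitian space as a real LINEAR map `H ↦ g H gᴴ`.
[cite: Borel1969, §12] -/
def coneActionLin (g : GL (Fin n) (mixedSpace K)) : hermSpace n K →ₗ[ℝ] hermSpace n K where
  toFun H := ⟨(g : Matrix (Fin n) (Fin n) (mixedSpace K)) * H *
      (g : Matrix (Fin n) (Fin n) (mixedSpace K))ᴴ, conj_mem_hermSpace _ H.2⟩
  map_add' A B := by
    refine Subtype.ext ?_
    simp only [Submodule.coe_add, Matrix.mul_add, Matrix.add_mul]
  map_smul' c A := by
    refine Subtype.ext ?_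
    simp only [Submodule.coe_smul, RingHom.id_apply, Matrix.mul_smul, Matrix.smul_mul]

/-- Unfolding lemma for `coneActionLin`. [folklore] -/
@[simp]
theorem coe_coneActionLin (g : GL (Fin n) (mixedSpace K)) (H : hermSpace n K) :
    ((coneActionLin n K g H : hermSpace n K) : Matrix (Fin n) (Fin n) (mixedSpace K)) =
      (g : Matrix (Fin n) (Fin n) (mixedSpace K)) * H * (g : Matrix (Fin n) (Fin n) (mixedSpace K))ᴴ :=
  rfl

/-- **The linear action** `coneAction n K : GL_n(K_∞) →* (hermSpace →L[ℝ] hermSpace)`,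
`g ↦ (H ↦ g H gᴴ)` (continuous because the space is finite-dimensional; a homomorphism since
`(g₁g₂) H (g₁g₂)ᴴ = g₁ (g₂ H g₂ᴴ) g₁ᴴ`). [cite: Borel1969, §12] -/
def coneAction [NumberField K] : GL (Fin n) (mixedSpace K) →* (hermSpace n K →L[ℝ] hermSpace n K) where
  toFun g := LinearMap.toContinuousLinearMap (coneActionLin n K g)
  map_one' := by
    refine ContinuousLinearMap.ext fun H => Subtype.ext ?_
    simp
  map_mul' g₁ g₂ := by
    refine ContinuousLinearMap.ext fun H => Subtype.ext ?_
    simp only [ContinuousLinearMap.mul_def, ContinuousLinearMap.coe_comp, Function.comp_apply,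
      LinearMap.coe_toContinuousLinearMap', coe_coneActionLin, Units.val_mul,
      Matrix.conjTranspose_mul, Matrix.mul_assoc]

/-- Unfolding lemma for `coneAction`. [folklore] -/
@[simp]
theorem coe_coneAction [NumberField K] (g : GL (Fin n) (mixedSpace K)) (H : hermSpace n K) :
    ((coneAction n K g H : hermSpace n K) : Matrix (Fin n) (Fin n) (mixedSpace K)) =
      (g : Matrix (Fin n) (Fin n) (mixedSpace K)) * H * (g : Matrix (Fin n) (Fin n) (mixedSpace K))ᴴ :=
  rfl

/-- **The action preserves the cone** (`(g H gᴴ)_w = g_w H_w g_wᴴ` with `g_w` a unit).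
[cite: Borel1969, §12] -/
theorem mapsTo_coneAction_posCone [NumberField K] (g : GL (Fin n) (mixedSpace K)) :
    MapsTo (coneAction n K g) (posCone n K) (posCone n K) := by
  -- adapted from Summits/…/HeckeEigenvalueFieldStubConeModel.lean (coneModel_invariant)
  rintro H ⟨hR, hC⟩
  refine ⟨fun w => ?_, fun w => ?_⟩
  · rw [coe_coneAction, Matrix.map_mul, Matrix.map_mul,
      Matrix.conjTranspose_map (mixedSpaceEvalReal K w) (fun _ => rfl)]
    exact (hR w).mul_mul_conjTranspose_same (Matrix.vecMul_injective_of_isUnit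
      ((Units.isUnit g).map (mixedSpaceEvalReal K w).mapMatrix))
  · rw [coe_coneAction, Matrix.map_mul, Matrix.map_mul,
      Matrix.conjTranspose_map (mixedSpaceEvalComplex K w) (fun _ => rfl)]
    exact (hC w).mul_mul_conjTranspose_same (Matrix.vecMul_injective_of_isUnit
      ((Units.isUnit g).map (mixedSpaceEvalComplex K w).mapMatrix))

/-! ### Rational points -/

/-- `GL_n(K) →* GL_n(K_∞)` through the mixed embedding `K →+* K_∞` entrywise. [folklore] -/
def toMixedGL : GL (Fin n) K →* GL (Fin n) (mixedSpace K) :=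
  Matrix.GeneralLinearGroup.map (mixedEmbedding K)

/-- Unfolding lemma for `toMixedGL`. [folklore] -/
@[simp]
theorem coe_toMixedGL (γ : GL (Fin n) K) :
    ((toMixedGL n K γ : GL (Fin n) (mixedSpace K)) : Matrix (Fin n) (Fin n) (mixedSpace K)) =
      (γ : Matrix (Fin n) (Fin n) K).map (mixedEmbedding K) :=
  rfl

/-- **The action of the rational points** `GL_n(K)` on the hermitian space, through the mixed
embedding: `γ ↦ (H ↦ γ H γᴴ)`. [cite: Borel1969, §12] -/
def coneActionRat [NumberField K] : GL (Fin n) K →* (hermSpace n K →L[ℝ] hermSpace n K) :=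
  (coneAction n K).comp (toMixedGL n K)

/-- Unfolding lemma for `coneActionRat`. [folklore] -/
theorem coneActionRat_apply [NumberField K] (γ : GL (Fin n) K) :
    coneActionRat n K γ = coneAction n K (toMixedGL n K γ) :=
  rfl

/-- The rational points preserve the cone. [folklore] -/
theorem mapsTo_coneActionRat_posCone [NumberField K] (γ : GL (Fin n) K) :
    MapsTo (coneActionRat n K γ) (posCone n K) (posCone n K) :=
  mapsTo_coneAction_posCone n K _

end ResGLnCone

end Literature.NumberTheory.Automorphic

end
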